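import Mathlib
import Summits.ResolutionOfSingularities.ResolutionOfSingularities.Theorems.WeightedInvariantLocalWeightedDropTOT2ChartSymbolicTransport
import Summits.ResolutionOfSingularities.ResolutionOfSingularities.Theorems.WeightedInvariantLocalWeightedDropTOT2ChartBranchWeierstrass
import Summits.ResolutionOfSingularities.ResolutionOfSingularities.Theorems.WeightedInvariantLocalWeightedDropTOT2ConflictBudgetDefs
import Summits.ResolutionOfSingularities.ResolutionOfSingularities.Theorems.WeightedInvariantLocalWeightedDropTOT2ChartGerms
import Summits.ResolutionOfSingularities.ResolutionOfSingularities.Theorems.WeightedInvariantLocalWeightedDropNCBranchPrimesReading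

/-!
# TOT2-LINE (P3) bricks B4-1 … B4-4: THE TOP-LOCUS PRIMES DESCEND ALONG THE FOUR CHART MAPS

Sub-problem `ResolutionOfSingularities`, ENGINE crux `stmt-ResolutionOfSingularities-8899` (`LocalWeightedDrop`), skeleton v35
(2e806da509994632), registered stub `stub_conflictBudget` (P3); typed split `L/res-L1-w43-stub-2/g6/P3_split_v1.lean`
(7fbb6274b2c57d05), bricks **B4-1 … B4-4** — "THE HARD BRICK" of the conflict budget: a top-locus prime `P′` of the transformed
label `A′` (symbolic power `monicGerm d A′ ∈ P′^(d)`) NOT containing the exceptional variable pulls back, along the chart map `Φ`,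
to a top-locus prime of `A`.  [OURS · L1 W4.3 · chain w43 · res-L1-w43-lead-1 g6; def-free; the bricks carry the extra binder
`hdim' : ringKrullDim (R₃ ⧸ P′) = 1` exactly as brick B3 does (announced on STATUS 2026-08-27T20:06Z) — height-one top-locus primes
(pure `d`-th powers) do not occur under the squarefree context of the budget laws; nothing here is a statement of any manuscript;
AI-produced, gate-checked, weaker than expert review.]

Proof: no excellence / G-ring input.  The chart kernels `…TOT2ChartWeierstrassPair` / `…MonomialMap` / `…SymbolicTransport` /
`…BranchWeierstrass` show that symbolic powers descend along `Φ_ε : (x,v,w) ↦ (x, x^{ε₁}v, x^{ε₂}w)` once `P′ ∌ x` has dimension one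
(Weierstrass elements of `P′` in `v` and `w` over `k⟦x⟧`, bounded denominators by complete Nakayama, injectivity modulo the Weierstrass
ideals by uniqueness of Weierstrass division).  The `u₁`-chart `(x, xv, xw)` and the curve chart `(x, v, xw)` are `Φ_{(1,1)}`,
`Φ_{(0,1)}` (`comap_mem_topPrimes_of_chart`); the `u₂`-chart and the `V(y,u₂)`-chart are their conjugates by the swap `x ↔ v`
(`exists_mul_mem_pow_comap_of_swap`), which preserves primes, dimensions and symbolic powers.  The germ identities
`Φ(monicGerm d A) = u^d · monicGerm d A′` are res-L1-w43-stub-2's bricks B5-L (`…TOT2ChartGerms`).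
-/

set_option linter.dupNamespace false -- mandated namespace of this single-conjunct summit

noncomputable section

namespace Summit.ResolutionOfSingularities.ResolutionOfSingularities.Theorems

namespace TOT2Branch

open MvPowerSeries IsLocalRing PolyDescent

variable {k : Type} [Field k]

/-! ## §1 The frame `x = X 0`: both charts with exceptional variable `u₁` -/

/-- **SYMBOLIC DESCENT IN THE FRAME `x = X 0`.**  For a chart `Φ` with `a 0 = X 0`, `a 1 = X 0^{ε₁} X 1`, `a 2 = X 0^{ε₂} X 2`, a
one-dimensional prime `P′ ∌ X 0` and `Φ(F) = X 0 ^ m · F′` with `F′ ∈ P′^(d)`: `Φ⁻¹P′` is a prime `≠ 𝔪` with `F ∈ (Φ⁻¹P′)^(d)`. -/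
theorem symbolic_comap_of_chart {a : Fin 3 → MvPowerSeries (Fin 3) k} (ha : HasSubst a) {ε₁ ε₂ : ℕ}
    (h0 : a 0 = X 0) (h1 : a 1 = X 0 ^ ε₁ * X 1) (h2 : a 2 = X 0 ^ ε₂ * X 2)
    {P' : Ideal (MvPowerSeries (Fin 3) k)} (hP' : P'.IsPrime) (hdim' : ringKrullDim (MvPowerSeries (Fin 3) k ⧸ P') = 1)
    (hx : (X 0 : MvPowerSeries (Fin 3) k) ∉ P') {F F' : MvPowerSeries (Fin 3) k} {m d : ℕ}
    (hF : substAlgHom (R := k) ha F = X 0 ^ m * F') (hF' : ∃ s', s' ∉ P' ∧ s' * F' ∈ P' ^ d) :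
    (P'.comap (substAlgHom (R := k) ha)).IsPrime ∧ P'.comap (substAlgHom (R := k) ha) ≠ maximalIdeal (MvPowerSeries (Fin 3) k) ∧
      ∃ t, t ∉ P'.comap (substAlgHom (R := k) ha) ∧ t * F ∈ (P'.comap (substAlgHom (R := k) ha)) ^ d := by
  haveI := hP'
  obtain ⟨α, av, hav, hWv⟩ := TOT2Chart.exists_weierstrass_mem P' hdim' hx 1
  obtain ⟨β, aw, haw, hWw⟩ := TOT2Chart.exists_weierstrass_mem P' hdim' hx 2
  refine ⟨Ideal.comap_isPrime _ _, fun h => hx ?_, ?_⟩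
  · have : (X 0 : MvPowerSeries (Fin 3) k) ∈ P'.comap (substAlgHom (R := k) ha) := by
      rw [h]; exact (WeierstrassForm.mem_maximalIdeal_iff _).mpr (constantCoeff_X _)
    rw [Ideal.mem_comap, TOT2Chart.substAlgHom_X_zero ha h0] at this
    exact this
  · exact TOT2Chart.exists_mul_mem_pow_comap ha h0 h1 h2 hav haw rfl rfl rfl rfl hP' hx hWv hWw hF hF'

/-- **B4-1 — `u₁`-CHART: a top-locus prime upstairs not containing the exceptional variable pulls back to a top-locus prime**
(one-dimensional primes; the `u₁`-chart is `Φ_{(1,1)}`). -/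
theorem comap_chartOne_mem_topPrimes {d : ℕ} (hd : 0 < d) (A : Fin d → MvPowerSeries (Fin 2) k) (hA : IsPosT d A)
    {P' : Ideal (MvPowerSeries (Fin 3) k)} (hP' : P' ∈ topPrimes d (blowOneT d A)) (hX : (X 0 : MvPowerSeries (Fin 3) k) ∉ P')
    (hdim' : ringKrullDim (MvPowerSeries (Fin 3) k ⧸ P') = 1) :
    P'.comap (substAlgHom (hasSubst_of_constantCoeff_zero (a := (![X 0, X 0 * X 1, X 0 * X 2] : Fin 3 → MvPowerSeries (Fin 3) k))
      (by intro i; fin_cases i <;> simp))) ∈ topPrimes d A := by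
  have _ := hd
  obtain ⟨hP'p, -, hsymb⟩ := hP'
  have ha : HasSubst (![X 0, X 0 * X 1, X 0 * X 2] : Fin 3 → MvPowerSeries (Fin 3) k) :=
    hasSubst_of_constantCoeff_zero (by intro i; fin_cases i <;> simp)
  have hF : substAlgHom (R := k) ha (NCPoly.monicGerm d A) = X 0 ^ d * NCPoly.monicGerm d (blowOneT d A) := by
    rw [coe_substAlgHom]; exact subst_chartOne_monicGerm A hA
  obtain ⟨hprime, hne, t, ht, htF⟩ :=
    symbolic_comap_of_chart (ε₁ := 1) (ε₂ := 1) ha rfl (by simp) (by simp) hP'p hdim' hX hF hsymb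
  exact ⟨hprime, hne, t, ht, htF⟩

/-- **B4-3 — `V(y,u₁)`-CHART** (one-dimensional primes; the curve chart is `Φ_{(0,1)}`). -/
theorem comap_chartDivOne_mem_topPrimes {d : ℕ} (hd : 0 < d) (A : Fin d → MvPowerSeries (Fin 2) k) (hA : IsPermissibleOneT d A)
    {P' : Ideal (MvPowerSeries (Fin 3) k)} (hP' : P' ∈ topPrimes d (divOneT d A)) (hX : (X 0 : MvPowerSeries (Fin 3) k) ∉ P')
    (hdim' : ringKrullDim (MvPowerSeries (Fin 3) k ⧸ P') = 1) :
    P'.comap (substAlgHom (hasSubst_of_constantCoeff_zero (a := (![X 0, X 1, X 0 * X 2] : Fin 3 → MvPowerSeries (Fin 3) k))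
      (by intro i; fin_cases i <;> simp))) ∈ topPrimes d A := by
  have _ := hd
  obtain ⟨hP'p, -, hsymb⟩ := hP'
  have ha : HasSubst (![X 0, X 1, X 0 * X 2] : Fin 3 → MvPowerSeries (Fin 3) k) :=
    hasSubst_of_constantCoeff_zero (by intro i; fin_cases i <;> simp)
  have hF : substAlgHom (R := k) ha (NCPoly.monicGerm d A) = X 0 ^ d * NCPoly.monicGerm d (divOneT d A) := by
    rw [coe_substAlgHom]; exact subst_chartDivOne_monicGerm A hA
  obtain ⟨hprime, hne, t, ht, htF⟩ :=
    symbolic_comap_of_chart (ε₁ := 0) (ε₂ := 1) ha rfl (by simp) (by simp) hP'p hdim' hX hF hsymb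
  exact ⟨hprime, hne, t, ht, htF⟩

/-! ## §2 The frame `x = X 1`: conjugation by the swap `X 0 ↔ X 1` -/

/-- The swap is an involution of `k⟦X₀,X₁,X₂⟧`. -/
theorem rename_swap_rename_swap (F : MvPowerSeries (Fin 3) k) :
    rename (Equiv.swap (0 : Fin 3) 1) (rename (Equiv.swap (0 : Fin 3) 1) F) = F := by
  have h : ((Equiv.swap (0 : Fin 3) 1) ∘ (Equiv.swap (0 : Fin 3) 1) : Fin 3 → Fin 3) = id :=
    funext (fun i => Equiv.swap_apply_self _ _ i)
  rw [rename_rename]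
  simp only [h, rename_id_apply]

/-- **CONJUGATION**: if `a (swap i) = swap (b i)` for all `i`, then `Φ_a ∘ swap = swap ∘ Φ_b`. -/
theorem substAlgHom_rename_swap {a b : Fin 3 → MvPowerSeries (Fin 3) k} (ha : HasSubst a) (hb : HasSubst b)
    (hab : ∀ i, a (Equiv.swap (0 : Fin 3) 1 i) = rename (Equiv.swap (0 : Fin 3) 1) (b i)) (F : MvPowerSeries (Fin 3) k) :
    substAlgHom (R := k) ha (rename (Equiv.swap (0 : Fin 3) 1) F) = rename (Equiv.swap (0 : Fin 3) 1) (substAlgHom (R := k) hb F) := by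
  have hX : HasSubst (X ∘ (Equiv.swap (0 : Fin 3) 1) : Fin 3 → MvPowerSeries (Fin 3) k) :=
    hasSubst_of_constantCoeff_zero (fun _ => constantCoeff_X _)
  rw [rename_eq_subst, coe_substAlgHom, subst_comp_subst_apply hX ha, coe_substAlgHom, rename_eq_subst, subst_comp_subst_apply hb hX]
  congr 1
  funext i
  rw [Function.comp_apply, subst_X ha, hab i, rename_eq_subst]

/-- **SYMBOLIC DESCENT TRANSPORTED THROUGH THE SWAP.**  With `Φ_a ∘ swap = swap ∘ Φ_b`: a symbolic-descent conclusion for `Φ_a` at the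
swapped prime `swap⁻¹P′` and the swapped series `swap F` gives the conclusion for `Φ_b` at `P′` and `F`. -/
theorem exists_mul_mem_pow_comap_of_swap {a b : Fin 3 → MvPowerSeries (Fin 3) k} (ha : HasSubst a) (hb : HasSubst b)
    (hab : ∀ i, a (Equiv.swap (0 : Fin 3) 1 i) = rename (Equiv.swap (0 : Fin 3) 1) (b i)) {P' : Ideal (MvPowerSeries (Fin 3) k)}
    {F : MvPowerSeries (Fin 3) k} {d : ℕ}
    (h : ∃ t, t ∉ (P'.comap (rename (Equiv.swap (0 : Fin 3) 1) : MvPowerSeries (Fin 3) k →ₐ[k] MvPowerSeries (Fin 3) k)).comap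
        (substAlgHom (R := k) ha) ∧
      t * rename (Equiv.swap (0 : Fin 3) 1) F ∈ ((P'.comap (rename (Equiv.swap (0 : Fin 3) 1) :
        MvPowerSeries (Fin 3) k →ₐ[k] MvPowerSeries (Fin 3) k)).comap (substAlgHom (R := k) ha)) ^ d) :
    ∃ u, u ∉ P'.comap (substAlgHom (R := k) hb) ∧ u * F ∈ (P'.comap (substAlgHom (R := k) hb)) ^ d := by
  set σ : MvPowerSeries (Fin 3) k →ₐ[k] MvPowerSeries (Fin 3) k := rename (Equiv.swap (0 : Fin 3) 1) with hσ
  set R := (P'.comap σ).comap (substAlgHom (R := k) ha) with hR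
  have hσσ : ∀ G, σ (σ G) = G := rename_swap_rename_swap
  have hcomap : P'.comap (substAlgHom (R := k) hb) = R.comap σ := by
    ext x
    rw [Ideal.mem_comap, hR, Ideal.mem_comap, Ideal.mem_comap, Ideal.mem_comap, hσ, substAlgHom_rename_swap ha hb hab,
      ← hσ, hσσ]
  obtain ⟨t, ht, htF⟩ := h
  refine ⟨σ t, ?_, ?_⟩
  · rw [hcomap, Ideal.mem_comap, hσσ]; exact ht
  · rw [hcomap]
    refine NCBranchPrimes.mem_pow_of_inverse σ.toRingHom σ.toRingHom hσσ (Q := R) (fun q hq => ?_) ?_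
    · change q ∈ _ at hq
      rw [Ideal.mem_comap]
      change σ (σ q) ∈ R
      rw [hσσ]; exact hq
    · change σ (σ t * F) ∈ R ^ d
      rw [map_mul, hσσ]; exact htF

/-- **SYMBOLIC DESCENT IN THE FRAME `x = X 1`** (charts with exceptional variable `u₂`): conjugate of `symbolic_comap_of_chart`. -/
theorem symbolic_comap_of_chart_swap {a b : Fin 3 → MvPowerSeries (Fin 3) k} (ha : HasSubst a) (hb : HasSubst b) {ε₁ ε₂ : ℕ}
    (h0 : a 0 = X 0) (h1 : a 1 = X 0 ^ ε₁ * X 1) (h2 : a 2 = X 0 ^ ε₂ * X 2)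
    (hab : ∀ i, a (Equiv.swap (0 : Fin 3) 1 i) = rename (Equiv.swap (0 : Fin 3) 1) (b i))
    {P' : Ideal (MvPowerSeries (Fin 3) k)} (hP' : P'.IsPrime) (hdim' : ringKrullDim (MvPowerSeries (Fin 3) k ⧸ P') = 1)
    (hx : (X 1 : MvPowerSeries (Fin 3) k) ∉ P') {F F' : MvPowerSeries (Fin 3) k} {m d : ℕ}
    (hF : substAlgHom (R := k) hb F = X 1 ^ m * F') (hF' : ∃ s', s' ∉ P' ∧ s' * F' ∈ P' ^ d) :
    (P'.comap (substAlgHom (R := k) hb)).IsPrime ∧ P'.comap (substAlgHom (R := k) hb) ≠ maximalIdeal (MvPowerSeries (Fin 3) k) ∧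
      ∃ t, t ∉ P'.comap (substAlgHom (R := k) hb) ∧ t * F ∈ (P'.comap (substAlgHom (R := k) hb)) ^ d := by
  haveI := hP'
  set σ : MvPowerSeries (Fin 3) k →ₐ[k] MvPowerSeries (Fin 3) k := rename (Equiv.swap (0 : Fin 3) 1) with hσ
  have hσσ : ∀ G, σ (σ G) = G := rename_swap_rename_swap
  -- the swapped prime
  set Q' := P'.comap σ with hQ'
  haveI hQ'p : Q'.IsPrime := Ideal.comap_isPrime σ P'
  have hxQ : (X 0 : MvPowerSeries (Fin 3) k) ∉ Q' := by
    rw [hQ', Ideal.mem_comap, hσ, rename_X]; exact hx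
  have hdimQ : ringKrullDim (MvPowerSeries (Fin 3) k ⧸ Q') = 1 := by
    let e : MvPowerSeries (Fin 3) k ≃+* MvPowerSeries (Fin 3) k := (renameEquiv k (Equiv.swap (0 : Fin 3) 1)).toRingEquiv
    have he : ∀ G, e G = σ G := fun G => rfl
    have hJ : P' = Q'.map (e : MvPowerSeries (Fin 3) k →+* MvPowerSeries (Fin 3) k) := by
      rw [Ideal.map_comap_of_equiv]
      ext x
      rw [Ideal.mem_comap, hQ', Ideal.mem_comap]
      change x ∈ P' ↔ σ (e.symm x) ∈ P'
      rw [← he, RingEquiv.apply_symm_apply]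
    rw [← hdim']
    exact ringKrullDim_eq_of_ringEquiv (Ideal.quotientEquiv Q' P' e hJ)
  -- the swapped germ identity and symbolic datum
  have hFσ : substAlgHom (R := k) ha (σ F) = X 0 ^ m * σ F' := by
    rw [hσ, substAlgHom_rename_swap ha hb hab, hF, map_mul, map_pow, rename_X]; rfl
  have hF'σ : ∃ s', s' ∉ Q' ∧ s' * σ F' ∈ Q' ^ d := by
    obtain ⟨s', hs', hs'F'⟩ := hF'
    refine ⟨σ s', by rw [hQ', Ideal.mem_comap, hσσ]; exact hs', ?_⟩
    rw [← map_mul]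
    exact NCBranchPrimes.mem_pow_of_inverse σ.toRingHom σ.toRingHom hσσ (Q := P')
      (fun q hq => by rw [hQ', Ideal.mem_comap]; change σ (σ q) ∈ P'; rw [hσσ]; exact hq)
      (by change σ (σ (s' * F')) ∈ P' ^ d; rw [hσσ]; exact hs'F')
  obtain ⟨-, -, hcore⟩ := symbolic_comap_of_chart ha h0 h1 h2 hQ'p hdimQ hxQ hFσ hF'σ
  refine ⟨Ideal.comap_isPrime _ _, fun h => hx ?_, exists_mul_mem_pow_comap_of_swap ha hb hab hcore⟩
  have : (X 1 : MvPowerSeries (Fin 3) k) ∈ P'.comap (substAlgHom (R := k) hb) := by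
    rw [h]; exact (WeierstrassForm.mem_maximalIdeal_iff _).mpr (constantCoeff_X _)
  rw [Ideal.mem_comap, substAlgHom_X] at this
  have hb1 : b 1 = X 1 := by
    have := hab 1
    rw [show Equiv.swap (0 : Fin 3) 1 1 = 0 from Equiv.swap_apply_right _ _, h0] at this
    apply (rename_injective (Equiv.swap (0 : Fin 3) 1).toEmbedding)
    change σ (b 1) = σ (X 1)
    rw [← this, hσ, rename_X]; rfl
  rw [hb1] at this
  exact this

/-- **B4-2 — `u₂`-CHART** (one-dimensional primes; conjugate of the `u₁`-chart by `u₁ ↔ u₂`). -/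
theorem comap_chartTwo_mem_topPrimes {d : ℕ} (hd : 0 < d) (A : Fin d → MvPowerSeries (Fin 2) k) (hA : IsPosT d A)
    {P' : Ideal (MvPowerSeries (Fin 3) k)} (hP' : P' ∈ topPrimes d (blowTwoT d A)) (hX : (X 1 : MvPowerSeries (Fin 3) k) ∉ P')
    (hdim' : ringKrullDim (MvPowerSeries (Fin 3) k ⧸ P') = 1) :
    P'.comap (substAlgHom (hasSubst_of_constantCoeff_zero (a := (![X 0 * X 1, X 1, X 1 * X 2] : Fin 3 → MvPowerSeries (Fin 3) k))
      (by intro i; fin_cases i <;> simp))) ∈ topPrimes d A := by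
  have _ := hd
  obtain ⟨hP'p, -, hsymb⟩ := hP'
  have hb : HasSubst (![X 0 * X 1, X 1, X 1 * X 2] : Fin 3 → MvPowerSeries (Fin 3) k) :=
    hasSubst_of_constantCoeff_zero (by intro i; fin_cases i <;> simp)
  have hF : substAlgHom (R := k) hb (NCPoly.monicGerm d A) = X 1 ^ d * NCPoly.monicGerm d (blowTwoT d A) := by
    rw [coe_substAlgHom]; exact subst_chartTwo_monicGerm A hA
  have ha : HasSubst (![X 0, X 0 * X 1, X 0 * X 2] : Fin 3 → MvPowerSeries (Fin 3) k) :=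
    hasSubst_of_constantCoeff_zero (by intro i; fin_cases i <;> simp)
  obtain ⟨hprime, hne, t, ht, htF⟩ := symbolic_comap_of_chart_swap (ε₁ := 1) (ε₂ := 1) ha hb rfl (by simp) (by simp)
    (by intro i; fin_cases i <;> simp [rename_X, Equiv.swap_apply_of_ne_of_ne, mul_comm]) hP'p hdim' hX hF hsymb
  exact ⟨hprime, hne, t, ht, htF⟩

/-- **B4-4 — `V(y,u₂)`-CHART** (one-dimensional primes; conjugate of the `V(y,u₁)`-chart by `u₁ ↔ u₂`). -/
theorem comap_chartDivTwo_mem_topPrimes {d : ℕ} (hd : 0 < d) (A : Fin d → MvPowerSeries (Fin 2) k) (hA : IsPermissibleTwoT d A)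
    {P' : Ideal (MvPowerSeries (Fin 3) k)} (hP' : P' ∈ topPrimes d (divTwoT d A)) (hX : (X 1 : MvPowerSeries (Fin 3) k) ∉ P')
    (hdim' : ringKrullDim (MvPowerSeries (Fin 3) k ⧸ P') = 1) :
    P'.comap (substAlgHom (hasSubst_of_constantCoeff_zero (a := (![X 0, X 1, X 1 * X 2] : Fin 3 → MvPowerSeries (Fin 3) k))
      (by intro i; fin_cases i <;> simp))) ∈ topPrimes d A := by
  have _ := hd
  obtain ⟨hP'p, -, hsymb⟩ := hP'
  have hb : HasSubst (![X 0, X 1, X 1 * X 2] : Fin 3 → MvPowerSeries (Fin 3) k) :=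
    hasSubst_of_constantCoeff_zero (by intro i; fin_cases i <;> simp)
  have hF : substAlgHom (R := k) hb (NCPoly.monicGerm d A) = X 1 ^ d * NCPoly.monicGerm d (divTwoT d A) := by
    rw [coe_substAlgHom]; exact subst_chartDivTwo_monicGerm A hA
  have ha : HasSubst (![X 0, X 1, X 0 * X 2] : Fin 3 → MvPowerSeries (Fin 3) k) :=
    hasSubst_of_constantCoeff_zero (by intro i; fin_cases i <;> simp)
  obtain ⟨hprime, hne, t, ht, htF⟩ := symbolic_comap_of_chart_swap (ε₁ := 0) (ε₂ := 1) ha hb rfl (by simp) (by simp)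
    (by intro i; fin_cases i <;> simp [rename_X, Equiv.swap_apply_of_ne_of_ne]) hP'p hdim' hX hF hsymb
  exact ⟨hprime, hne, t, ht, htF⟩

end TOT2Branch

end Summit.ResolutionOfSingularities.ResolutionOfSingularities.Theorems

end
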